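import Summits.QuantumFields.BalabanUV.T4Continuum.Support.AveragingDeficitBlockDensityPush
import HarnessLib

/-!
# AveragingDeficitLiftDefectSum (T⁴ programme, node NE3, row NE3-R2, gen 6) — THE LIFT DEFECT ON THE TORUS:
# `dirSq (pushDir∘S₀ − Id)φ ([0,M)^d) ≤ 2d·covGradSq (cavg L U) φ ([0,M)^d) + 2d(2·nbRad+1)^d·kPush²·a²·dirSq φ ([0,M)^d)`, and the
# elementary `covGradSq V Ψ ([0,N)^d) ≤ 4d·dirSq Ψ ([0,N)^d)` (file 7 of (γ2) — record `t4/T4-EST-NE3-R2.md` v0.6 §4)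

HONEST FRAMING (cell `pub-balaban`, T4-DAG PAGE 1; unit `b2b-balaban-t4-ne3r2-p1` = owner of BINDER-OWNERS row NE3-R2, gen 6).
The cell's T4 target is the finite-torus continuum limit of the unit-scale averaged loop expectations — NOT infinite volume, NO
mass gap, NOT Clay, NOT summit progress.  WHY.  File 6 (`AveragingDeficitBlockDensityPush.norm_liftDefect_le`) bounds the lift defect
`ψ = pushDir L U ∘ S₀ − Id` pointwise by the coarse covariant differences at the bond plus `kPush·a·s` for any local sup `s` of the
datum around the bond.  THIS FILE sums the squares over one coarse period with the local sup `s_y = (Σ_{y″∈box_R(y)} Σ_μ ‖φ(y″,μ)‖²)^{1/2}`,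
`R = nbRad d L` (every fine point within `ℓ¹`-distance `nbRad` of `Ly` has its coarse site in `box_R(y)`, `cdiv_mem_box`), the double count
`Σ_y Σ_{box_R(y)} ≤ (2R+1)^d Σ` being this row's `AveragingDeficitPeriodicCounting.sum_periodBox_box_le` (at `L = 1`).  All [folklore],
0 sorry: §1 `natAbs_le_l1`, `cdiv_mem_box`, the local sup `locSup` and its defining property; §2 **`dirSq_liftDefect_le`**; §2b the `ℓ¹`
version (`covGradL1`, `locMass`, **`dirL1_liftDefect_le`**: `dirL1 ψ ≤ covGradL1 (cavg L U) φ + d(2·nbRad+1)^d·kPush·a·dirL1 φ`); §3 the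
elementary bound **`covGradSq_le_dirSq`**: `covGradSq V Ψ (periodBox N) ≤ 4d·dirSq Ψ (periodBox N)` for unitary `V` and `N`-periodic `Ψ`
(each covariant difference is a difference of two isometrically transported values).  NE3 ITSELF IS NOT PROVED; nothing of Bałaban's is
asserted (context: [Balaban1985Averaging] (42) p. 23; [Balaban1985Variational] (75)–(77) p. 289).  ABSOLUTE RULE kept: no printed
sentence is a hypothesis.  PLACEMENT: `Summits/QuantumFields/BalabanUV/`; imports this row's `AveragingDeficitBlockDensityPush`; moves nothing.
-/

set_option autoImplicit false

open scoped BigOperators Matrix Matrix.Norms.L2Operator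
open NormedSpace Finset

namespace Summit.QuantumFields.BalabanUV.T4Continuum.AveragingDeficitLiftDefectSum

open Literature.MathematicalPhysics.QuantumFieldTheory.Balaban1983to89
open B7Prop1Explicit B7Prop2Explicit MatrixLog UnitaryModel
open T4AveragingDeficitWall hiding Site Plane Plaq Bond
open T4AveragingDeficitWallBoundary (IsPeriodicCfg periodBox sum_periodBox_shift)
open T4AveragingDeficitNonAbelian (Ad_mul Ad_sub)
open AveragingDeficitTransport (norm_Ad_of_unitary)
open AveragingDeficitCounting (mem_box_iff)
open AveragingDeficitPeriodicCounting (IsPeriodicDir sum_periodBox_box_le)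
open AveragingDeficitChartCalculus (cavg)
open AveragingDeficitCovGrad (covFd covGradSq)
open SkeletonLattice (cdiv cmod smul_cdiv_add_cmod cmod_nonneg cmod_lt)
open BlockAverageVaryHolo (nbRad)
open AveragingDeficitBlockDensity AveragingDeficitBlockDensityPush

noncomputable section

variable {d : ℕ} {n : Type*} [Fintype n] [DecidableEq n]

/-! ## §1 Coarse sites of nearby fine points; the local sup -/

omit [Fintype n] [DecidableEq n] in
/-- One coordinate is bounded by the `ℓ¹` size. [folklore] -/
theorem natAbs_le_l1 (v : Site d) (i : Fin d) : (v i).natAbs ≤ l1 v :=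
  Finset.single_le_sum (f := fun κ => (v κ).natAbs) (fun _ _ => Nat.zero_le _) (Finset.mem_univ i)

omit [Fintype n] [DecidableEq n] in
/-- **A fine point within `ℓ¹`-distance `R` of the corner `Ly` has its coarse site in `box_R(y)`.** [folklore] -/
theorem cdiv_mem_box {L : ℕ} (hL : 1 ≤ L) {R : ℕ} {x y : Site d} (hx : l1 (x - (L : ℤ) • y) ≤ R) : cdiv L x ∈ box R y := by
  rw [mem_box_iff]
  intro i
  have h1 : ((x - (L : ℤ) • y) i).natAbs ≤ R := (natAbs_le_l1 _ i).trans hx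
  have h2 : |x i - (L : ℤ) * y i| ≤ (R : ℤ) := by
    have : ((x - (L : ℤ) • y) i) = x i - (L : ℤ) * y i := by simp
    rw [← this, ← Int.natCast_natAbs]; exact_mod_cast h1
  have hrepr : (L : ℤ) * cdiv L x i + cmod L x i = x i := by
    have := congr_fun (smul_cdiv_add_cmod L x) i
    simpa using this
  have hm0 := cmod_nonneg hL x i
  have hmL := cmod_lt hL x i
  have hL1 : (1 : ℤ) ≤ L := by exact_mod_cast hL
  have hR0 : (0 : ℤ) ≤ R := by positivity
  obtain ⟨hlo, hhi⟩ := abs_le.mp h2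
  rw [abs_le]
  constructor
  · -- lower bound: `c ≥ y_i − R`
    by_contra hc
    push Not at hc
    have hc' : cdiv L x i ≤ y i - R - 1 := by linarith
    have : (L : ℤ) * cdiv L x i ≤ (L : ℤ) * (y i - R - 1) := mul_le_mul_of_nonneg_left hc' (by linarith)
    nlinarith
  · -- upper bound: `c ≤ y_i + R`
    by_contra hc
    push Not at hc
    have hc' : y i + R + 1 ≤ cdiv L x i := by linarith
    have : (L : ℤ) * (y i + R + 1) ≤ (L : ℤ) * cdiv L x i := mul_le_mul_of_nonneg_left hc' (by linarith)
    nlinarith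

/-- THE LOCAL SUP of the coarse datum around `y`: `(Σ_{y″∈box_R(y)} Σ_μ ‖φ(y″,μ)‖²)^{1/2}`, `R = nbRad d L`. [folklore] -/
def locSup (L : ℕ) (φ : Site d → Fin d → Matrix n n ℂ) (y : Site d) : ℝ :=
  Real.sqrt (∑ z ∈ box (nbRad d L) y, ∑ μ : Fin d, ‖φ z μ‖ ^ 2)

/-- `locSup ≥ 0`. [folklore] -/
theorem locSup_nonneg (L : ℕ) (φ : Site d → Fin d → Matrix n n ℂ) (y : Site d) : 0 ≤ locSup L φ y := Real.sqrt_nonneg _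

/-- `locSup² = Σ_{box} Σ_μ ‖φ‖²`. [folklore] -/
theorem locSup_sq (L : ℕ) (φ : Site d → Fin d → Matrix n n ℂ) (y : Site d) :
    locSup L φ y ^ 2 = ∑ z ∈ box (nbRad d L) y, ∑ μ : Fin d, ‖φ z μ‖ ^ 2 :=
  Real.sq_sqrt (Finset.sum_nonneg fun _ _ => Finset.sum_nonneg fun _ _ => by positivity)

/-- **THE LOCAL SUP DOMINATES `φ` ON THE COARSE SITES OF NEARBY FINE POINTS.** [folklore] -/
theorem norm_le_locSup {L : ℕ} (hL : 1 ≤ L) (φ : Site d → Fin d → Matrix n n ℂ) (y : Site d) :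
    ∀ (x : Site d) (μ : Fin d), l1 (x - (L : ℤ) • y) ≤ nbRad d L → ‖φ (cdiv L x) μ‖ ≤ locSup L φ y := by
  intro x μ hx
  have hmem := cdiv_mem_box hL hx
  rw [locSup, Real.le_sqrt (norm_nonneg _) (Finset.sum_nonneg fun _ _ => Finset.sum_nonneg fun _ _ => by positivity)]
  calc ‖φ (cdiv L x) μ‖ ^ 2 ≤ ∑ ν : Fin d, ‖φ (cdiv L x) ν‖ ^ 2 :=
        Finset.single_le_sum (f := fun ν => ‖φ (cdiv L x) ν‖ ^ 2) (fun _ _ => by positivity) (Finset.mem_univ μ)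
    _ ≤ ∑ z ∈ box (nbRad d L) y, ∑ ν : Fin d, ‖φ z ν‖ ^ 2 :=
        Finset.single_le_sum (f := fun z => ∑ ν : Fin d, ‖φ z ν‖ ^ 2) (fun _ _ => Finset.sum_nonneg fun _ _ => by positivity) hmem

/-- The double count of the local sups over one coarse period: `Σ_y locSup(y)² ≤ (2·nbRad+1)^d·dirSq φ ([0,M)^d)` for `M`-periodic `φ`.
[folklore] -/
theorem sum_locSup_sq_le (L : ℕ) {M : ℕ} (hM : 1 ≤ M) {φ : Site d → Fin d → Matrix n n ℂ} (hφ : IsPeriodicDir φ (M : ℤ)) :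
    ∑ y ∈ periodBox M, locSup L φ y ^ 2 ≤ (2 * nbRad d L + 1) ^ d * dirSq φ (periodBox M) := by
  simp only [locSup_sq]
  have h := sum_periodBox_box_le (d := d) 1 M le_rfl hM (nbRad d L) (g := fun z => ∑ μ : Fin d, ‖φ z μ‖ ^ 2)
    (fun _ => Finset.sum_nonneg fun _ _ => by positivity)
    (fun x κ => by
      simp only [Nat.one_mul]
      exact Finset.sum_congr rfl fun μ _ => by rw [hφ x κ μ])
  simp only [Nat.cast_one, one_smul, Nat.one_mul] at h
  unfold dirSq
  exact_mod_cast h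

/-! ## §2 The lift defect over one coarse period -/

section Small

variable [Nonempty n] {L : ℕ} (hL : 1 ≤ L) {U : Site d → Fin d → (Matrix n n ℂ)ˣ} (hU : IsUnitaryCfg U) {a : ℝ} (ha : 0 ≤ a)
  (h512 : 512 * (d + 1) * (d + 4) * (L : ℝ) ^ 2 * a ≤ 1) (hUa : SmallField U a)

include hL hU ha h512 hUa

/-- Pointwise, squared: `‖ψ(y,κ)‖² ≤ 2d·Σ_j ‖covFd V̄ φ y κ j‖² + 2·kPush²·a²·locSup(y)²`. [folklore] -/
theorem normSq_liftDefect_le (φ : Site d → Fin d → Matrix n n ℂ) (y : Site d) (κ : Fin d) :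
    ‖liftDefect L U φ y κ‖ ^ 2
      ≤ 2 * d * ∑ j : Fin d, ‖covFd (cavg L U) φ y κ j‖ ^ 2 + 2 * (kPush d L * a) ^ 2 * locSup L φ y ^ 2 := by
  have h := norm_liftDefect_le hL hU ha h512 hUa φ y κ (norm_le_locSup hL φ y)
  set A := ∑ j : Fin d, ‖covFd (cavg L U) φ y κ j‖ with hA
  set B := kPush d L * a * locSup L φ y with hB
  have hA0 : 0 ≤ A := Finset.sum_nonneg fun _ _ => norm_nonneg _
  have hB0 : 0 ≤ B := by
    rw [hB]; have := locSup_nonneg L φ y; have : 0 ≤ kPush d L := by unfold kPush cDb; positivity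
    positivity
  -- Cauchy–Schwarz for the sum of `d` norms
  have hCS : A ^ 2 ≤ d * ∑ j : Fin d, ‖covFd (cavg L U) φ y κ j‖ ^ 2 := by
    have h1 := sq_sum_le_card_mul_sum_sq (s := (Finset.univ : Finset (Fin d))) (f := fun j => ‖covFd (cavg L U) φ y κ j‖)
    rw [Finset.card_univ, Fintype.card_fin] at h1
    exact h1
  have h0 : 0 ≤ ‖liftDefect L U φ y κ‖ := norm_nonneg _
  calc ‖liftDefect L U φ y κ‖ ^ 2 ≤ (A + B) ^ 2 := pow_le_pow_left₀ h0 h 2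
    _ ≤ 2 * A ^ 2 + 2 * B ^ 2 := by nlinarith [sq_nonneg (A - B)]
    _ ≤ 2 * (d * ∑ j : Fin d, ‖covFd (cavg L U) φ y κ j‖ ^ 2) + 2 * B ^ 2 := by linarith
    _ = _ := by rw [hB]; ring

/-- **THE LIFT DEFECT OVER ONE COARSE PERIOD**: for `U` unitary in `SmallField U a` with `512(d+1)(d+4)L²a ≤ 1` and `φ` of period `M ≥ 1`,
`dirSq ψ ([0,M)^d) ≤ 2d·covGradSq (cavg L U) φ ([0,M)^d) + 2d(2·nbRad+1)^d·kPush²·a²·dirSq φ ([0,M)^d)`. [folklore] -/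
theorem dirSq_liftDefect_le {M : ℕ} (hM : 1 ≤ M) {φ : Site d → Fin d → Matrix n n ℂ} (hφ : IsPeriodicDir φ (M : ℤ)) :
    dirSq (liftDefect L U φ) (periodBox M)
      ≤ 2 * d * covGradSq (cavg L U) φ (periodBox M)
        + 2 * d * (2 * nbRad d L + 1) ^ d * (kPush d L * a) ^ 2 * dirSq φ (periodBox M) := by
  unfold dirSq covGradSq
  have hbox := sum_locSup_sq_le (d := d) L hM hφ
  have hk0 : 0 ≤ (kPush d L * a) ^ 2 := sq_nonneg _
  calc ∑ y ∈ periodBox M, ∑ κ : Fin d, ‖liftDefect L U φ y κ‖ ^ 2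
      ≤ ∑ y ∈ periodBox M, ∑ κ : Fin d,
          (2 * d * ∑ j : Fin d, ‖covFd (cavg L U) φ y κ j‖ ^ 2 + 2 * (kPush d L * a) ^ 2 * locSup L φ y ^ 2) :=
        Finset.sum_le_sum fun y _ => Finset.sum_le_sum fun κ _ => normSq_liftDefect_le hL hU ha h512 hUa φ y κ
    _ = 2 * d * ∑ y ∈ periodBox M, ∑ κ : Fin d, ∑ j : Fin d, ‖covFd (cavg L U) φ y κ j‖ ^ 2
        + 2 * d * (kPush d L * a) ^ 2 * ∑ y ∈ periodBox M, locSup L φ y ^ 2 := by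
        simp only [Finset.sum_add_distrib, Finset.mul_sum, Finset.sum_const, Finset.card_univ, Fintype.card_fin, nsmul_eq_mul]
        congr 1
        exact Finset.sum_congr rfl fun y _ => by ring
    _ ≤ _ := by
        unfold dirSq at hbox
        nlinarith [hbox, hk0, mul_nonneg (mul_nonneg (by positivity : (0 : ℝ) ≤ 2 * d) hk0)
          (sub_nonneg.mpr hbox)]

end Small

/-! ## §2b The `ℓ¹` version -/

/-- THE `ℓ¹` NORM OF THE COVARIANT GRADIENT over the site set `F`: `Σ_{x∈F} Σ_{μ,ν} ‖covFd V ψ x μ ν‖`. [folklore] -/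
def covGradL1 (V : Site d → Fin d → (Matrix n n ℂ)ˣ) (ψ : Site d → Fin d → Matrix n n ℂ) (F : Finset (Site d)) : ℝ :=
  ∑ x ∈ F, ∑ μ : Fin d, ∑ ν : Fin d, ‖covFd V ψ x μ ν‖

/-- THE LOCAL MASS of the coarse datum around `y`: `Σ_{y″∈box_R(y)} Σ_μ ‖φ(y″,μ)‖`, `R = nbRad d L` (an `ℓ¹` local sup). [folklore] -/
def locMass (L : ℕ) (φ : Site d → Fin d → Matrix n n ℂ) (y : Site d) : ℝ :=
  ∑ z ∈ box (nbRad d L) y, ∑ μ : Fin d, ‖φ z μ‖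

/-- The local mass dominates `φ` on the coarse sites of nearby fine points. [folklore] -/
theorem norm_le_locMass {L : ℕ} (hL : 1 ≤ L) (φ : Site d → Fin d → Matrix n n ℂ) (y : Site d) :
    ∀ (x : Site d) (μ : Fin d), l1 (x - (L : ℤ) • y) ≤ nbRad d L → ‖φ (cdiv L x) μ‖ ≤ locMass L φ y := by
  intro x μ hx
  have hmem := cdiv_mem_box hL hx
  unfold locMass
  calc ‖φ (cdiv L x) μ‖ ≤ ∑ ν : Fin d, ‖φ (cdiv L x) ν‖ :=
        Finset.single_le_sum (f := fun ν => ‖φ (cdiv L x) ν‖) (fun _ _ => norm_nonneg _) (Finset.mem_univ μ)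
    _ ≤ ∑ z ∈ box (nbRad d L) y, ∑ ν : Fin d, ‖φ z ν‖ :=
        Finset.single_le_sum (f := fun z => ∑ ν : Fin d, ‖φ z ν‖) (fun _ _ => Finset.sum_nonneg fun _ _ => norm_nonneg _) hmem

/-- The double count of the local masses: `Σ_y locMass(y) ≤ (2·nbRad+1)^d·dirL1 φ ([0,M)^d)` for `M`-periodic `φ`. [folklore] -/
theorem sum_locMass_le (L : ℕ) {M : ℕ} (hM : 1 ≤ M) {φ : Site d → Fin d → Matrix n n ℂ} (hφ : IsPeriodicDir φ (M : ℤ)) :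
    ∑ y ∈ periodBox M, locMass L φ y ≤ (2 * nbRad d L + 1) ^ d * dirL1 φ (periodBox M) := by
  unfold locMass
  have h := sum_periodBox_box_le (d := d) 1 M le_rfl hM (nbRad d L) (g := fun z => ∑ μ : Fin d, ‖φ z μ‖)
    (fun _ => Finset.sum_nonneg fun _ _ => norm_nonneg _)
    (fun x κ => by
      simp only [Nat.one_mul]
      exact Finset.sum_congr rfl fun μ _ => by rw [hφ x κ μ])
  simp only [Nat.cast_one, one_smul, Nat.one_mul] at h
  unfold dirL1
  exact_mod_cast h

section SmallL1

variable [Nonempty n] {L : ℕ} (hL : 1 ≤ L) {U : Site d → Fin d → (Matrix n n ℂ)ˣ} (hU : IsUnitaryCfg U) {a : ℝ} (ha : 0 ≤ a)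
  (h512 : 512 * (d + 1) * (d + 4) * (L : ℝ) ^ 2 * a ≤ 1) (hUa : SmallField U a)

include hL hU ha h512 hUa

/-- **THE LIFT DEFECT OVER ONE COARSE PERIOD, `ℓ¹`**: `dirL1 ψ ([0,M)^d) ≤ covGradL1 (cavg L U) φ ([0,M)^d) + d(2·nbRad+1)^d·kPush·a·dirL1 φ ([0,M)^d)`.
[folklore] -/
theorem dirL1_liftDefect_le {M : ℕ} (hM : 1 ≤ M) {φ : Site d → Fin d → Matrix n n ℂ} (hφ : IsPeriodicDir φ (M : ℤ)) :
    dirL1 (liftDefect L U φ) (periodBox M)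
      ≤ covGradL1 (cavg L U) φ (periodBox M) + d * (2 * nbRad d L + 1) ^ d * (kPush d L * a) * dirL1 φ (periodBox M) := by
  unfold dirL1 covGradL1
  have hmass := sum_locMass_le (d := d) L hM hφ
  have hk0 : 0 ≤ kPush d L * a := mul_nonneg (by unfold kPush cDb; positivity) ha
  calc ∑ y ∈ periodBox M, ∑ κ : Fin d, ‖liftDefect L U φ y κ‖
      ≤ ∑ y ∈ periodBox M, ∑ κ : Fin d, (∑ j : Fin d, ‖covFd (cavg L U) φ y κ j‖ + kPush d L * a * locMass L φ y) :=
        Finset.sum_le_sum fun y _ => Finset.sum_le_sum fun κ _ =>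
          norm_liftDefect_le hL hU ha h512 hUa φ y κ (norm_le_locMass hL φ y)
    _ = ∑ y ∈ periodBox M, ∑ κ : Fin d, ∑ j : Fin d, ‖covFd (cavg L U) φ y κ j‖
        + d * (kPush d L * a) * ∑ y ∈ periodBox M, locMass L φ y := by
        simp only [Finset.sum_add_distrib, Finset.sum_const, Finset.card_univ, Fintype.card_fin, nsmul_eq_mul, Finset.mul_sum]
        congr 1
        exact Finset.sum_congr rfl fun y _ => by ring
    _ ≤ _ := by
        unfold dirL1 at hmass
        nlinarith [hmass, hk0, mul_nonneg (mul_nonneg (Nat.cast_nonneg d) hk0) (sub_nonneg.mpr hmass)]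

end SmallL1

/-! ## §3 The covariant gradient against the plain `ℓ²` norm -/

/-- **`covGradSq V Ψ ([0,N)^d) ≤ 4d·dirSq Ψ ([0,N)^d)`** for unitary `V` and `N`-periodic `Ψ` (`N ≥ 1`): each covariant difference is
`Ad_{…}Ψ(x+e_μ,ν) − Ad_{…}Ψ(x,ν)`, two isometrically transported values; the shifted sums are folded back by periodicity. [folklore] -/
theorem covGradSq_le_dirSq {N : ℕ} (hN : 1 ≤ N) {V : Site d → Fin d → (Matrix n n ℂ)ˣ} (hV : IsUnitaryCfg V)
    {Ψ : Site d → Fin d → Matrix n n ℂ} (hΨ : IsPeriodicDir Ψ (N : ℤ)) :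
    covGradSq V Ψ (periodBox N) ≤ 4 * d * dirSq Ψ (periodBox N) := by
  have hpt : ∀ (x : Site d) (μ ν : Fin d), ‖covFd V Ψ x μ ν‖ ^ 2 ≤ 2 * ‖Ψ (x + e μ) ν‖ ^ 2 + 2 * ‖Ψ x ν‖ ^ 2 := by
    intro x μ ν
    have h1 : ‖covFd V Ψ x μ ν‖ ≤ ‖Ψ (x + e μ) ν‖ + ‖Ψ x ν‖ := by
      unfold AveragingDeficitCovGrad.covFd
      refine (norm_sub_le _ _).trans ?_
      rw [norm_Ad_of_unitary ((unitaryUnits _).mul_mem (hV x μ) (hV _ ν)), norm_Ad_of_unitary (hV x ν)]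
    have h0 : 0 ≤ ‖covFd V Ψ x μ ν‖ := norm_nonneg _
    nlinarith [sq_nonneg (‖Ψ (x + e μ) ν‖ - ‖Ψ x ν‖), norm_nonneg (Ψ (x + e μ) ν), norm_nonneg (Ψ x ν)]
  have hshift : ∀ μ : Fin d, ∑ x ∈ periodBox N, ∑ ν : Fin d, ‖Ψ (x + e μ) ν‖ ^ 2 = dirSq Ψ (periodBox N) := fun μ => by
    unfold dirSq
    exact sum_periodBox_shift N hN (g := fun x => ∑ ν : Fin d, ‖Ψ x ν‖ ^ 2) (fun x κ => by simp only [hΨ x κ]) (e μ)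
  unfold covGradSq
  calc ∑ x ∈ periodBox N, ∑ μ : Fin d, ∑ ν : Fin d, ‖covFd V Ψ x μ ν‖ ^ 2
      ≤ ∑ x ∈ periodBox N, ∑ μ : Fin d, ∑ ν : Fin d, (2 * ‖Ψ (x + e μ) ν‖ ^ 2 + 2 * ‖Ψ x ν‖ ^ 2) :=
        Finset.sum_le_sum fun x _ => Finset.sum_le_sum fun μ _ => Finset.sum_le_sum fun ν _ => hpt x μ ν
    _ = ∑ μ : Fin d, (2 * ∑ x ∈ periodBox N, ∑ ν : Fin d, ‖Ψ (x + e μ) ν‖ ^ 2 + 2 * ∑ x ∈ periodBox N, ∑ ν : Fin d, ‖Ψ x ν‖ ^ 2) := by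
        rw [Finset.sum_comm]
        refine Finset.sum_congr rfl fun μ _ => ?_
        simp only [Finset.sum_add_distrib, Finset.mul_sum]
    _ = 4 * d * dirSq Ψ (periodBox N) := by
        simp only [hshift]
        unfold dirSq
        rw [Finset.sum_const, Finset.card_univ, Fintype.card_fin, nsmul_eq_mul]
        ring

end

end Summit.QuantumFields.BalabanUV.T4Continuum.AveragingDeficitLiftDefectSum
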